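import Summits.QuantumFields.YangMills.Theses.UnitScaleTilt
import Literature.MathematicalPhysics.QuantumFieldTheory.Balaban1983to89.LatticeWordStokes

/-!
# Route `UnitScaleTilt` — crux K2 `HistoryTail` (stmt-QuantumFields-18916): WALK LOCALITY — the sites `walkEnd x v`, `|v| ≤ n`, lie in the
# `ℓ∞`-ball of radius `n` around `x`, so plaquette smallness ON A COORDINATE BOX implies the walk-local hypothesis of the local Stokes chain
# (support file; brick S3-loc₃ of the split card)

Fleet lead `ym-ust-18916-p1` (gen 0); split card `CARD-18916-K2-split.md` (evidence #12/#16).  The local (69)–(71) chain of this seat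
(`HistoryTailStokesLocal` p443816, `…FirstOrderLoops` p444852, `…FirstOrderLocal`/`…SmallFactorLocal` pending) asks, per bond `c`, that every
plaquette cornered at a site `walkEnd (emb c₋) v` with `|v| ≤ (d+2)L + 2` be small — the form the swap calculus produces.  The regularity input of
mechanism A ([Balaban1985UV3] (68): «on B^j(Λ_j)») is GEOMETRIC: smallness of the plaquettes cornered in a coordinate box.  THIS FILE bridges the
two: `abs_netDisp_le_length` (`|netDisp v ν| ≤ |v|`), **`walkEnd_mem_box`** (every coordinate of `walkEnd x v` is `x ν + e` with `|e| ≤ |v|`), and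
**`walkLocal_of_box`** — if every plaquette `⟨z, a, b⟩` whose corner `z` satisfies `∀ ν, ∃ e : ℤ, |e| ≤ n ∧ z ν = x ν + e` is within `δ` of `1`,
then the walk-local hypothesis with radius `n` holds at `x`.

WHAT THIS IS NOT: bookkeeping only; nothing of (41)/(47); nothing uses (α).
-/

noncomputable section

namespace Summit.QuantumFields.YangMills.Theorems.HistoryTailWalkLocality

open Literature.MathematicalPhysics.QuantumFieldTheory.Balaban1983to89
open T4Continuum T4ReflectionCone

variable {P : Params} {j : ℕ} {G : Type*} [GaugeGroup G]

/-- `|netDisp v ν| ≤ |v|`: each letter moves at most one step in each direction. [folklore] -/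
theorem abs_netDisp_le_length {d : ℕ} (ν : Fin d) : ∀ v : List (Letter d), |netDisp v ν| ≤ v.length
  | [] => by simp [netDisp]
  | l :: v => by
    rw [netDisp_cons, List.length_cons]
    have ih := abs_netDisp_le_length ν v
    have hl : |(if l.1 = ν then (if l.2 then (1 : ℤ) else -1) else 0)| ≤ 1 := by
      split_ifs <;> simp
    calc |(if l.1 = ν then (if l.2 then (1 : ℤ) else -1) else 0) + netDisp v ν|
        ≤ |(if l.1 = ν then (if l.2 then (1 : ℤ) else -1) else 0)| + |netDisp v ν| := abs_add_le _ _
      _ ≤ 1 + (v.length : ℤ) := add_le_add hl ih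
      _ = ((v.length + 1 : ℕ) : ℤ) := by push_cast; ring

/-- **`walkEnd x v` LIES IN THE `ℓ∞`-BALL OF RADIUS `|v|` AROUND `x`**: every coordinate is `x ν + e` with `e ∈ ℤ`, `|e| ≤ |v|`
(`walkEnd_apply`). [folklore] -/
theorem walkEnd_mem_box (x : Site P j) (v : List (Letter P.d)) (ν : Fin P.d) :
    ∃ e : ℤ, |e| ≤ v.length ∧ walkEnd x v ν = x ν + (e : ZMod (P.sitesPerDir j)) :=
  ⟨netDisp v ν, abs_netDisp_le_length ν v, walkEnd_apply x v ν⟩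

/-- **BOX SMALLNESS ⇒ WALK-LOCAL SMALLNESS**: if every plaquette `⟨z, a, b⟩` cornered at a site `z` of the `ℓ∞`-ball of radius `n` around `x`
(`∀ ν, ∃ e, |e| ≤ n ∧ z ν = x ν + e`) is within `δ` of `1`, then so is every plaquette cornered at `walkEnd x v`, `|v| ≤ n` — the hypothesis
shape of `HistoryTailStokesLocal.dist1_holAt_le_loc` / `dist1_loopHol_le_loc` (there with `n + 2`, resp. `(d+2)L + 2`). [folklore] -/
theorem walkLocal_of_box (U : GaugeField P j G) (x : Site P j) (n : ℕ) {δ : ℝ}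
    (hbox : ∀ z : Site P j, (∀ ν, ∃ e : ℤ, |e| ≤ n ∧ z ν = x ν + (e : ZMod (P.sitesPerDir j))) →
      ∀ (a b : Fin P.d) (h : a < b), dist1 (GaugeField.plaqHol U ⟨z, a, b, h⟩) ≤ δ) :
    ∀ v : List (Letter P.d), v.length ≤ n →
      ∀ (a b : Fin P.d) (h : a < b), dist1 (GaugeField.plaqHol U ⟨walkEnd x v, a, b, h⟩) ≤ δ := by
  intro v hv a b h
  refine hbox (walkEnd x v) (fun ν => ?_) a b h
  obtain ⟨e, he, hw⟩ := walkEnd_mem_box x v ν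
  exact ⟨e, he.trans (by exact_mod_cast hv), hw⟩

end Summit.QuantumFields.YangMills.Theorems.HistoryTailWalkLocality

end
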